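import Literature.MathematicalPhysics.QuantumLattice.LatticeGaugeDLRFreeEnergyProofs
import HarnessLib

/-!
# `energy_tendsto_logFree_box`: the free-boundary box pressures converge to the torus pressure

Helper (E3) of the energy programme of crux `FibreToTorus` (stmt-QuantumFields-16244), line
`Sketch`, route `ContractibleFibre`.  For a continuous matrix representation `ρ` of a compact
second-countable group `G`, every `d` and every real `β`, the free-boundary pressures
`(n+1)^{-d} log Z(A_n)` of the boxes of plaquettes `A_n = [0, n)^d × {planes}` (partition
function `Z(A) = ∫ ∏_{p ∈ A} exp(-β (N - Re tr ρ(U_p))) dg_∞` against the infinite product Haar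
measure `zdHaar`) converge, as `n → ∞`, to the torus free energy density
`freeEnergyDensity d ρ β` of `LatticeGaugeDLR`.

Proof (Friedli–Velenik 2017, Ch. 3, Thm. 3.6: the pressure does not depend on the boundary
condition; folklore): the sub-box estimate `FreeEnergy.abs_torusLogPartition_sub_le` of
`LatticeGaugeDLRFreeEnergyProofs` with a single sub-box (`m = L = n + 1`) reads
`|log Z_{Λ_{n+1}} - log Z(A_n)| ≤ |β| (N + M) · #planes · ((n+1)^d - n^d)`; dividing by
`(n+1)^d` the right-hand side is `|β| (N + M) #planes (1 - (n/(n+1))^d) → 0`, and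
`(n+1)^{-d} log Z_{Λ_{n+1}} → freeEnergyDensity d ρ β` by the discharged existence of the torus
pressure (`exists_hasFreeEnergyDensity_holds`, `hasFreeEnergyDensity_freeEnergyDensity`).
-/

noncomputable section

open MeasureTheory Filter Topology Finset
open Literature.Probability.LatticeModels (Site halfOpenBox glueWith)
open Literature.MathematicalPhysics.QuantumLattice (LGConfig ZdEdge ZdPlaquette plaquetteObs plaquetteEdges
  plaquettesTouching wilsonBoundaryAction ymSpecification ymGibbsMeasures IsZdTranslationInvariant
  freeEnergyDensity configShift)
open Literature.MathematicalPhysics.QuantumFieldTheory (haarProbability zdHaar)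

namespace Summit.QuantumFields.YangMills.Theorems.FibreToTorus

/-- **The torus versus one free box** (the case `m = L = n + 1` of the sub-box estimate
`FreeEnergy.abs_torusLogPartition_sub_le`; Friedli–Velenik 2017, proof of Thm. 3.6, "comparing
`Z^∅` and `Z^{per}`"): `|log Z_{Λ_{n+1}} - log Z(A_n)| ≤ |β| (N + M) · #planes · ((n+1)^d - n^d)`.
[folklore] -/
theorem energy_abs_torusLogPartition_sub_logFree_box_le {d N : ℕ} {G : Type} [Group G]
    [TopologicalSpace G] [IsTopologicalGroup G] [CompactSpace G] [MeasurableSpace G] [BorelSpace G]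
    [SecondCountableTopology G] (ρ : G →* Matrix (Fin N) (Fin N) ℂ) (hρ : Continuous ρ) {M : ℝ}
    (hM : ∀ g, |(ρ g).trace.re| ≤ M) (β : ℝ) (n : ℕ) :
    |Literature.MathematicalPhysics.QuantumLattice.torusLogPartition d ρ β (n + 1) -
        Real.log (∫ U, ∏ p ∈ (halfOpenBox d n ×ˢ
          (Finset.univ : Finset {q : Fin d × Fin d // q.1 < q.2})),
          Real.exp (-β * ((N : ℝ) - plaquetteObs ρ p.1 p.2.1.1 p.2.1.2 U)) ∂(zdHaar d G))| ≤
      |β| * (N + M) * (Fintype.card {q : Fin d × Fin d // q.1 < q.2} *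
        (((n + 1 : ℕ) : ℝ) ^ d - (n : ℝ) ^ d)) := by
  -- adapted from LatticeGaugeAsymptoticsFreeEnergyProofs (`abs_torusLogPartition_sub_log_le`)
  have h := Literature.MathematicalPhysics.QuantumLattice.FreeEnergy.abs_torusLogPartition_sub_le
    (d := d) ρ hρ hM β (n + 1) (n + 1) (Nat.succ_le_succ (Nat.zero_le n))
  have hdiv : (n + 1) / (n + 1) = 1 := Nat.div_self n.succ_pos
  simp only [hdiv, one_pow, Nat.cast_one, one_mul, Nat.add_sub_cancel] at h
  exact h

/-- **The free-boundary box pressures converge to the torus pressure** (helper E3 of the energy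
programme of crux `FibreToTorus`, line `Sketch`): for a continuous matrix representation `ρ` of a
compact second-countable group, every `d` and every real `β`,
`(n+1)^{-d} log Z(A_n) → freeEnergyDensity d ρ β` as `n → ∞`, where
`Z(A_n) = ∫ ∏_{p ∈ [0,n)^d × planes} exp(-β (N - Re tr ρ(U_p))) dg_∞` is the free-boundary
partition function of the box of plaquettes based in `[0, n)^d` (Friedli–Velenik 2017, Ch. 3,
Thm. 3.6: independence of the pressure from the boundary condition). [folklore] -/
theorem energy_tendsto_logFree_box : ∀ (d N : ℕ) (G : Type) [Group G] [TopologicalSpace G] [IsTopologicalGroup G] [CompactSpace G] [MeasurableSpace G] [BorelSpace G] [SecondCountableTopology G] (ρ : G →* Matrix (Fin N) (Fin N) ℂ), Continuous ρ → ∀ β : ℝ, Filter.Tendsto (fun n : ℕ => (((n + 1 : ℕ) : ℝ) ^ d)⁻¹ * Real.log (∫ U, ∏ p ∈ (halfOpenBox d n ×ˢ (Finset.univ : Finset {q : Fin d × Fin d // q.1 < q.2})), Real.exp (-β * ((N : ℝ) - plaquetteObs ρ p.1 p.2.1.1 p.2.1.2 U)) ∂(zdHaar d G))) Filter.atTop (nhds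 (freeEnergyDensity d ρ β)) := by
  intro d N G _ _ _ _ _ _ _ ρ hρ β
  -- adapted from LatticeGaugeAsymptoticsFreeEnergyProofs (`tendsto_freeEnergyPerSite_halfOpenBox`)
  obtain ⟨M, hM0, hM⟩ :=
    Literature.MathematicalPhysics.QuantumFieldTheory.exists_bound_trace_re_nonneg ρ hρ
  have hf : Literature.MathematicalPhysics.QuantumLattice.HasFreeEnergyDensity d ρ β
      (freeEnergyDensity d ρ β) :=
    Literature.MathematicalPhysics.QuantumLattice.hasFreeEnergyDensity_freeEnergyDensity ρ
      (Literature.MathematicalPhysics.QuantumLattice.exists_hasFreeEnergyDensity_holds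
        (d := d) ρ hρ β)
  set D : ℕ := Fintype.card {q : Fin d × Fin d // q.1 < q.2} with hD
  set K : ℝ := |β| * (N + M) with hK
  set Z : ℕ → ℝ := fun n => ∫ U, ∏ p ∈ (halfOpenBox d n ×ˢ
      (Finset.univ : Finset {q : Fin d × Fin d // q.1 < q.2})),
      Real.exp (-β * ((N : ℝ) - plaquetteObs ρ p.1 p.2.1.1 p.2.1.2 U)) ∂(zdHaar d G) with hZ
  set b : ℕ → ℝ := fun n => (((n + 1 : ℕ) : ℝ) ^ d)⁻¹ *
    Literature.MathematicalPhysics.QuantumLattice.torusLogPartition d ρ β (n + 1) with hb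
  have hfb : Tendsto b atTop (𝓝 (freeEnergyDensity d ρ β)) := hf
  -- the pointwise bound `|c_{n+1} - b_n| ≤ K D (1 - (n/(n+1))^d)`
  have hpt : ∀ n : ℕ, |(((n + 1 : ℕ) : ℝ) ^ d)⁻¹ * Real.log (Z n) - b n| ≤
      K * D * (1 - ((n : ℝ) / ((n + 1 : ℕ) : ℝ)) ^ d) := by
    intro n
    set s : ℝ := ((n + 1 : ℕ) : ℝ) ^ d with hs
    have hs0 : 0 < s := by positivity
    have hs1 : s ≠ 0 := hs0.ne'
    have h1 : |Literature.MathematicalPhysics.QuantumLattice.torusLogPartition d ρ β (n + 1) -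
        Real.log (Z n)| ≤ K * (D * (s - (n : ℝ) ^ d)) :=
      energy_abs_torusLogPartition_sub_logFree_box_le ρ hρ hM β n
    have hss : s⁻¹ * s = 1 := inv_mul_cancel₀ hs1
    have hratio : s⁻¹ * (K * (D * (s - (n : ℝ) ^ d))) =
        K * D * (1 - ((n : ℝ) / ((n + 1 : ℕ) : ℝ)) ^ d) := by
      rw [div_pow, ← hs, div_eq_mul_inv]
      linear_combination (K * D) * hss
    rw [hb]
    simp only
    rw [← mul_sub, abs_mul, abs_of_pos (inv_pos.2 hs0), abs_sub_comm]
    calc s⁻¹ * |Literature.MathematicalPhysics.QuantumLattice.torusLogPartition d ρ β (n + 1) -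
          Real.log (Z n)| ≤ s⁻¹ * (K * (D * (s - (n : ℝ) ^ d))) :=
          mul_le_mul_of_nonneg_left h1 (inv_pos.2 hs0).le
      _ = K * D * (1 - ((n : ℝ) / ((n + 1 : ℕ) : ℝ)) ^ d) := hratio
  -- the bound tends to `0`
  have hbd : Tendsto (fun n : ℕ => K * D * (1 - ((n : ℝ) / ((n + 1 : ℕ) : ℝ)) ^ d)) atTop
      (𝓝 (K * D * (1 - 1 ^ d))) := by
    refine (tendsto_const_nhds.sub (Tendsto.pow ?_ d)).const_mul _
    exact (tendsto_natCast_div_add_atTop (1 : ℝ)).congr fun n => by rw [Nat.cast_succ]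
  rw [one_pow, sub_self, mul_zero] at hbd
  have hdiff : Tendsto (fun n : ℕ => (((n + 1 : ℕ) : ℝ) ^ d)⁻¹ * Real.log (Z n) - b n) atTop
      (𝓝 0) :=
    squeeze_zero_norm (fun n => by rw [Real.norm_eq_abs]; exact hpt n) hbd
  have h := hdiff.add hfb
  rw [zero_add] at h
  refine h.congr fun n => ?_
  rw [sub_add_cancel]

end Summit.QuantumFields.YangMills.Theorems.FibreToTorus

end
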